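import Summits.PneNP.PneNP.Theorems.KrwChromaticSteeringStrongCompositionLradRealisability

/-!
# Crux line `lrad-gluing` (stmt-PneNP-18538), the glued adversary I: rectangle and state lemmas

The bookkeeping of the gluing adversary (closed skeleton `Cruxes/StrongComposition/Lines/lrad_gluing.lean` §8,
commit 5a5f8789ebd3), over the objects of `KrwChromaticSteeringStrongCompositionLradDefs.lean`:

* rectangle lemmas of a Karchmer–Wigderson game (`Hard.split_alice/bob` = one-bit subadditivity, leaves,
  nonemptiness, role swap) — verbatim M3 (`Cruxes/StrongComposition/LensNegationP5g17.lean` §1);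
* M3's label / row-set bookkeeping (`AE`, `RA`, `Alive`, `cst`, `rowChild`) — verbatim M3 §2 — and its fibred
  form over a COMMON affine system `E` (`XSetE_inter_label`, `XSetE_rowChild`, `XSetE_cons`), loads of extended
  systems (`rowLoad_cons…`), the typing discipline `StateOK` under the three node types and the pin equation,
  and fibred realisation INSIDE the state (`exists_XE`, `exists_XE_row`, from S2).

FRONTIER rung of the KRW programme; nothing here bears on P vs NP.
-/

set_option linter.dupNamespace false -- `Summit.PneNP.PneNP.…`: summit = sub-problem name (D-0017 single-conjunct layout)
set_option autoImplicit false

namespace Summit.PneNP.PneNP.Theorems.KrwLrad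

open Literature.Computability.Complexity

universe u

/-! ## Rectangle lemmas [verbatim `LabelPublic` §1 of `LensNegationP5g17.lean`] -/
section RectLemmas

variable {ι : Type u}

/-- Every rectangle is `0`-hard. -/
theorem hard_zero (A B : Set (ι → Bool)) : Hard A B 0 := fun _ _ => Nat.zero_le _

/-- A rectangle solved by a leaf has no positive lower bound. -/
theorem Hard.eq_zero_of_leaf {A B : Set (ι → Bool)} {ℓ : ℕ} (h : Hard A B ℓ) {i : ι}
    (hi : SolvesRect (KWTree.leaf i) A B) : ℓ = 0 := by
  have := h _ hi
  simpa using this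

/-- A hard rectangle (`ℓ ≥ 1`) has a nonempty Alice side (given any coordinate to name). -/
theorem Hard.nonempty_left {A B : Set (ι → Bool)} {ℓ : ℕ} (h : Hard A B ℓ) (hℓ : 1 ≤ ℓ) (i : ι) :
    A.Nonempty := by
  by_contra hA
  rw [Set.not_nonempty_iff_eq_empty] at hA
  have h0 : ℓ = 0 := h.eq_zero_of_leaf (i := i) (by intro a ha; simp [hA] at ha)
  omega

/-- A hard rectangle (`ℓ ≥ 1`) has a nonempty Bob side. -/
theorem Hard.nonempty_right {A B : Set (ι → Bool)} {ℓ : ℕ} (h : Hard A B ℓ) (hℓ : 1 ≤ ℓ) (i : ι) :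
    B.Nonempty := by
  by_contra hB
  rw [Set.not_nonempty_iff_eq_empty] at hB
  have h0 : ℓ = 0 := h.eq_zero_of_leaf (i := i) (by intro a ha b hb; simp [hB] at hb)
  omega

/-- **One-bit subadditivity, Alice side** [verbatim `LabelPublic.Hard.split_alice`]. -/
theorem Hard.split_alice {A B : Set (ι → Bool)} {ℓ : ℕ} (h : Hard A B ℓ) (hA : A.Nonempty) (i₀ : ι)
    (φ : (ι → Bool) → Bool) :
    ∃ β : Bool, (A ∩ {a | φ a = β}).Nonempty ∧ Hard (A ∩ {a | φ a = β}) B (ℓ - 1) := by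
  classical
  by_cases hℓ : ℓ ≤ 1
  · obtain ⟨a, ha⟩ := hA
    refine ⟨φ a, ⟨a, ha, rfl⟩, ?_⟩
    have : ℓ - 1 = 0 := by omega
    rw [this]
    exact hard_zero _ _
  · have key : ∃ β : Bool, Hard (A ∩ {a | φ a = β}) B (ℓ - 1) := by
      by_contra hcon
      push Not at hcon
      have h0 := hcon false
      have h1 := hcon true
      simp only [Hard, not_forall, not_le] at h0 h1
      obtain ⟨Q0, hQ0, hd0⟩ := h0
      obtain ⟨Q1, hQ1, hd1⟩ := h1
      have hsol : SolvesRect (KWTree.alice φ Q0 Q1) A B := by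
        intro a ha b hb
        by_cases hφ : φ a = true
        · simp only [KWTree.run_alice, hφ, if_true]
          exact hQ1 a ⟨ha, hφ⟩ b hb
        · simp only [KWTree.run_alice, hφ]
          exact hQ0 a ⟨ha, by simpa using hφ⟩ b hb
      have := h _ hsol
      simp only [KWTree.depth_alice] at this
      omega
    obtain ⟨β, hβ⟩ := key
    exact ⟨β, hβ.nonempty_left (by omega) i₀, hβ⟩

/-- **One-bit subadditivity, Bob side** [verbatim `LabelPublic.Hard.split_bob`]. -/
theorem Hard.split_bob {A B : Set (ι → Bool)} {ℓ : ℕ} (h : Hard A B ℓ) (hB : B.Nonempty) (i₀ : ι)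
    (φ : (ι → Bool) → Bool) :
    ∃ β : Bool, (B ∩ {b | φ b = β}).Nonempty ∧ Hard A (B ∩ {b | φ b = β}) (ℓ - 1) := by
  classical
  by_cases hℓ : ℓ ≤ 1
  · obtain ⟨b, hb⟩ := hB
    refine ⟨φ b, ⟨b, hb, rfl⟩, ?_⟩
    have : ℓ - 1 = 0 := by omega
    rw [this]
    exact hard_zero _ _
  · have key : ∃ β : Bool, Hard A (B ∩ {b | φ b = β}) (ℓ - 1) := by
      by_contra hcon
      push Not at hcon
      have h0 := hcon false
      have h1 := hcon true
      simp only [Hard, not_forall, not_le] at h0 h1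
      obtain ⟨Q0, hQ0, hd0⟩ := h0
      obtain ⟨Q1, hQ1, hd1⟩ := h1
      have hsol : SolvesRect (KWTree.bob φ Q0 Q1) A B := by
        intro a ha b hb
        by_cases hφ : φ b = true
        · simp only [KWTree.run_bob, hφ, if_true]
          exact hQ1 a ha b ⟨hb, hφ⟩
        · simp only [KWTree.run_bob, hφ]
          exact hQ0 a ha b ⟨hb, by simpa using hφ⟩
      have := h _ hsol
      simp only [KWTree.depth_bob] at this
      omega
    obtain ⟨β, hβ⟩ := key
    exact ⟨β, hβ.nonempty_right (by omega) i₀, hβ⟩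

end RectLemmas

/-! ## State lemmas -/
section StateLemmas

variable {m n : ℕ} {g : (Fin n → Bool) → Bool} {q : ℕ}

/-- Parity on a singleton support is the entry. -/
@[simp] theorem parityOn_singleton (p : Fin m × Fin n) (X : Fin m × Fin n → Bool) :
    parityOn {p} X = X p := by
  unfold parityOn
  cases h : X p <;> simp [Finset.filter_singleton, h]

/-- Row loads of an extended system. -/
theorem rowLoad_cons (e : Finset (Fin m × Fin n) × Bool) (E : AffSys m n) (i : Fin m) :
    rowLoad (e :: E) i = rowLoad E i + (if i ∈ eqRows e.1 then 1 else 0) := by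
  unfold rowLoad
  rw [List.filter_cons]
  by_cases h : i ∈ eqRows e.1
  · simp [h]
  · simp [h]

/-- Adding one equation raises each row load by at most one. -/
theorem rowLoad_cons_le (e : Finset (Fin m × Fin n) × Bool) (E : AffSys m n) (i : Fin m) :
    rowLoad (e :: E) i ≤ rowLoad E i + 1 := by
  rw [rowLoad_cons]
  split <;> omega

/-- Adding an equation not touching row `i` keeps its load. -/
theorem rowLoad_cons_of_not_mem (e : Finset (Fin m × Fin n) × Bool) (E : AffSys m n) {i : Fin m}
    (h : i ∉ eqRows e.1) : rowLoad (e :: E) i = rowLoad E i := by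
  rw [rowLoad_cons, if_neg h, Nat.add_zero]

/-- The empty system has zero loads. -/
theorem rowLoad_nil (i : Fin m) : rowLoad ([] : AffSys m n) i = 0 := rfl

/-- A singleton support touches exactly its own row. -/
theorem mem_eqRows_singleton {p : Fin m × Fin n} {i : Fin m} :
    i ∈ eqRows ({p} : Finset (Fin m × Fin n)) ↔ i = p.1 := by
  simp [eqRows]

/-- `cst ≤ 1`. -/
theorem cst_le_one (E : Set (Fin m → Bool)) (i : Fin m) : cst E i ≤ 1 := by
  unfold cst; split <;> simp

/-- `cst` is antitone in the set. -/
theorem cst_mono {E E' : Set (Fin m → Bool)} (h : E' ⊆ E) (i : Fin m) : cst E i ≤ cst E' i := by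
  classical
  unfold cst
  by_cases hE : ∃ v, ∀ a ∈ E, a i = v
  · obtain ⟨v, hv⟩ := hE
    have hE' : ∃ v, ∀ a ∈ E', a i = v := ⟨v, fun a ha => hv a (h ha)⟩
    rw [if_pos ⟨v, hv⟩, if_pos hE']
  · rw [if_neg hE]; exact Nat.zero_le _

/-- `cst = 1` on a set constant at coordinate `i`. -/
theorem cst_eq_one {E : Set (Fin m → Bool)} {i : Fin m} {v : Bool} (h : ∀ a ∈ E, a i = v) :
    cst E i = 1 := by
  classical
  unfold cst; rw [if_pos ⟨v, h⟩]

/-- `cst = 0` on a set with two vectors differing at coordinate `i`. -/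
theorem cst_eq_zero {E : Set (Fin m → Bool)} {i : Fin m} {a a' : Fin m → Bool} (ha : a ∈ E)
    (ha' : a' ∈ E) (h : a i ≠ a' i) : cst E i = 0 := by
  classical
  unfold cst
  rw [if_neg]
  rintro ⟨v, hv⟩
  exact h ((hv a ha).trans (hv a' ha').symm)

/-- Realisable label columns lie in the label set. -/
theorem AE_subset {A : Set (Fin m → Bool)} {S : Fin m → Set (Fin n → Bool)} : AE g A S ⊆ A :=
  fun _ ha => ha.1

/-- Aliveness is monotone in the realisable label sets. -/
theorem Alive.mono {A A' B B' : Set (Fin m → Bool)} {S S' T T' : Fin m → Set (Fin n → Bool)}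
    {i : Fin m} {α : Bool} (h : Alive g A' B' S' T' i α) (hA : AE g A' S' ⊆ AE g A S)
    (hB : AE g B' T' ⊆ AE g B T) : Alive g A B S T i α :=
  ⟨h.1.imp fun _ ⟨ha, hai⟩ => ⟨hA ha, hai⟩, h.2.imp fun _ ⟨hb, hbi⟩ => ⟨hB hb, hbi⟩⟩

/-- Label test: intersect the label set. -/
theorem AE_inter_label (A : Set (Fin m → Bool)) (S : Fin m → Set (Fin n → Bool))
    (φ : (Fin m → Bool) → Bool) (β : Bool) :
    AE g (A ∩ {a | φ a = β}) S = AE g A S ∩ {a | φ a = β} := by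
  ext a; simp only [AE, Set.mem_setOf_eq, Set.mem_inter_iff]; tauto

/-- Label test: intersect the fibred matrix set by the label condition. -/
theorem XSetE_inter_label (A : Set (Fin m → Bool)) (S : Fin m → Set (Fin n → Bool)) (E : AffSys m n)
    (φ : (Fin m → Bool) → Bool) (β : Bool) :
    XSetE g (A ∩ {a | φ a = β}) S E = XSetE g A S E ∩ {X | φ (rowLabels g X) = β} := by
  ext X; simp only [XSetE, Set.mem_setOf_eq, Set.mem_inter_iff]; tauto

/-- The shrunk row-set at the tested row. -/
theorem rowChild_self (S : Fin m → Set (Fin n → Bool)) (i : Fin m) (ψ : (Fin n → Bool) → Bool)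
    (β : Bool) : rowChild S i ψ β i = S i ∩ {x | ψ x = β} := by
  simp [rowChild]

/-- `rowChild` leaves the other row-sets unchanged. -/
theorem rowChild_of_ne (S : Fin m → Set (Fin n → Bool)) {i i' : Fin m} (ψ : (Fin n → Bool) → Bool)
    (β : Bool) (h : i' ≠ i) : rowChild S i ψ β i' = S i' := by
  simp [rowChild, h]

/-- `rowChild` only shrinks row-sets. -/
theorem rowChild_subset (S : Fin m → Set (Fin n → Bool)) (i : Fin m) (ψ : (Fin n → Bool) → Bool)
    (β : Bool) (i' : Fin m) : rowChild S i ψ β i' ⊆ S i' := by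
  by_cases h : i' = i
  · subst h; rw [rowChild_self]; exact Set.inter_subset_left
  · rw [rowChild_of_ne _ _ _ h]

/-- Row test: intersect the fibred matrix set by the row condition. -/
theorem XSetE_rowChild (A : Set (Fin m → Bool)) (S : Fin m → Set (Fin n → Bool)) (E : AffSys m n)
    (i : Fin m) (ψ : (Fin n → Bool) → Bool) (β : Bool) :
    XSetE g A (rowChild S i ψ β) E = XSetE g A S E ∩ {X | ψ (row X i) = β} := by
  ext X
  simp only [XSetE, Set.mem_setOf_eq, Set.mem_inter_iff]
  constructor
  · rintro ⟨hA, hS, hE⟩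
    have hi := hS i
    rw [rowChild_self] at hi
    exact ⟨⟨hA, fun i' => rowChild_subset S i ψ β i' (hS i'), hE⟩, hi.2⟩
  · rintro ⟨⟨hA, hS, hE⟩, hψ⟩
    refine ⟨hA, fun i' => ?_, hE⟩
    by_cases h : i' = i
    · subst h; rw [rowChild_self]; exact ⟨hS i', hψ⟩
    · rw [rowChild_of_ne _ _ _ h]; exact hS i'

/-- The part of the row game of `(i, α)` surviving the answer `β`. -/
theorem RA_rowChild_self (S : Fin m → Set (Fin n → Bool)) (i : Fin m) (ψ : (Fin n → Bool) → Bool)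
    (β α : Bool) : RA g (rowChild S i ψ β) i α = RA g S i α ∩ {x | ψ x = β} := by
  ext x; simp only [RA, rowChild_self, Set.mem_inter_iff, Set.mem_setOf_eq]; tauto

/-- Row games of other rows are unchanged by `rowChild`. -/
theorem RA_rowChild_of_ne (S : Fin m → Set (Fin n → Bool)) {i i' : Fin m} (ψ : (Fin n → Bool) → Bool)
    (β α : Bool) (h : i' ≠ i) : RA g (rowChild S i ψ β) i' α = RA g S i' α := by
  simp only [RA, rowChild_of_ne _ _ _ h]

/-- Realisable label columns only shrink under `rowChild`. -/
theorem AE_rowChild_subset (A : Set (Fin m → Bool)) (S : Fin m → Set (Fin n → Bool)) (i : Fin m)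
    (ψ : (Fin n → Bool) → Bool) (β : Bool) : AE g A (rowChild S i ψ β) ⊆ AE g A S := by
  rintro a ⟨haA, hreal⟩
  exact ⟨haA, fun i' => (hreal i').imp fun x ⟨hx, hgx⟩ => ⟨rowChild_subset S i ψ β i' hx, hgx⟩⟩

/-- A realisable column stays realisable after the row answer iff its own part of row `i` survives. -/
theorem mem_AE_rowChild {A : Set (Fin m → Bool)} {S : Fin m → Set (Fin n → Bool)} {i : Fin m}
    {ψ : (Fin n → Bool) → Bool} {β : Bool} {a : Fin m → Bool} (ha : a ∈ AE g A S)
    (hpart : (RA g S i (a i) ∩ {x | ψ x = β}).Nonempty) : a ∈ AE g A (rowChild S i ψ β) := by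
  refine ⟨ha.1, fun i' => ?_⟩
  by_cases h : i' = i
  · subst h
    obtain ⟨x, ⟨hxS, hgx⟩, hψ⟩ := hpart
    exact ⟨x, by rw [rowChild_self]; exact ⟨hxS, hψ⟩, hgx⟩
  · rw [rowChild_of_ne _ _ _ h]; exact ha.2 i'

/-- Adding an equation to the common system cuts the fibred set by that equation. -/
theorem XSetE_cons (A : Set (Fin m → Bool)) (S : Fin m → Set (Fin n → Bool)) (E : AffSys m n)
    (e : Finset (Fin m × Fin n) × Bool) :
    XSetE g A S (e :: E) = XSetE g A S E ∩ {X | parityOn e.1 X = e.2} := by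
  ext X
  simp only [XSetE, Sat, Set.mem_setOf_eq, Set.mem_inter_iff, List.forall_mem_cons]
  tauto

/-- Typing discipline ⟹ every row is equation-free or row-set-free (Alice side). -/
theorem StateOK.typed_left {τ : Fin m → RowType} {S T : Fin m → Set (Fin n → Bool)} {E : AffSys m n}
    (h : StateOK τ S T E) (i : Fin m) : rowLoad E i = 0 ∨ S i = Set.univ := by
  by_cases hτ : τ i = RowType.algebraic
  · exact Or.inr ((h i).2 (by rw [hτ]; exact fun h' => RowType.noConfusion h')).1
  · exact Or.inl ((h i).1 hτ)

/-- Typing discipline ⟹ every row is equation-free or row-set-free (Bob side). -/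
theorem StateOK.typed_right {τ : Fin m → RowType} {S T : Fin m → Set (Fin n → Bool)} {E : AffSys m n}
    (h : StateOK τ S T E) (i : Fin m) : rowLoad E i = 0 ∨ T i = Set.univ := by
  by_cases hτ : τ i = RowType.algebraic
  · exact Or.inr ((h i).2 (by rw [hτ]; exact fun h' => RowType.noConfusion h')).2
  · exact Or.inl ((h i).1 hτ)

/-- The typing below a single-row test on a non-algebraic row `i` (Alice's row-set shrinks). -/
theorem StateOK.rowChild_left {τ : Fin m → RowType} {S T : Fin m → Set (Fin n → Bool)}
    {E : AffSys m n} (h : StateOK τ S T E) {i : Fin m} (hτi : τ i ≠ RowType.algebraic)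
    (ψ : (Fin n → Bool) → Bool) (β : Bool) :
    StateOK (Function.update τ i RowType.combinatorial) (rowChild S i ψ β) T E := by
  intro i'
  by_cases hi : i' = i
  · subst hi
    rw [Function.update_self]
    exact ⟨fun _ => (h i').1 hτi, fun h' => (h' rfl).elim⟩
  · rw [Function.update_of_ne hi, rowChild_of_ne _ _ _ hi]
    exact h i'

/-- The typing below a single-row test on a non-algebraic row `i` (Bob's row-set shrinks). -/
theorem StateOK.rowChild_right {τ : Fin m → RowType} {S T : Fin m → Set (Fin n → Bool)}
    {E : AffSys m n} (h : StateOK τ S T E) {i : Fin m} (hτi : τ i ≠ RowType.algebraic)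
    (ψ : (Fin n → Bool) → Bool) (β : Bool) :
    StateOK (Function.update τ i RowType.combinatorial) S (rowChild T i ψ β) E := by
  intro i'
  by_cases hi : i' = i
  · subst hi
    rw [Function.update_self]
    exact ⟨fun _ => (h i').1 hτi, fun h' => (h' rfl).elim⟩
  · rw [Function.update_of_ne hi, rowChild_of_ne _ _ _ hi]
    exact h i'

/-- The typing below an affine test avoiding combinatorial rows, its equation added to `E`. -/
theorem StateOK.retag_cons {τ : Fin m → RowType} {S T : Fin m → Set (Fin n → Bool)} {E : AffSys m n}
    (h : StateOK τ S T E) {S₀ : Finset (Fin m × Fin n)}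
    (hτ : ∀ i ∈ touchedRows S₀, τ i ≠ RowType.combinatorial) (b : Bool) :
    StateOK (retag S₀ τ) S T ((S₀, b) :: E) := by
  intro i
  by_cases hmem : i ∈ touchedRows S₀
  · have hτi : retag S₀ τ i = RowType.algebraic := by simp [retag, hmem]
    rw [hτi]
    exact ⟨fun h' => (h' rfl).elim, fun _ => (h i).2 (hτ i hmem)⟩
  · have hτi : retag S₀ τ i = τ i := by simp [retag, hmem]
    rw [hτi, rowLoad_cons_of_not_mem _ _ hmem]
    exact h i

/-- The pin equation `X_p = b` keeps the typing when row `p.1` is algebraic. -/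
theorem StateOK.pin_cons {τ : Fin m → RowType} {S T : Fin m → Set (Fin n → Bool)} {E : AffSys m n}
    (h : StateOK τ S T E) {p : Fin m × Fin n} (hp : τ p.1 = RowType.algebraic) (b : Bool) :
    StateOK τ S T (({p}, b) :: E) := by
  intro i
  by_cases hi : i = p.1
  · rw [hi, hp]
    exact ⟨fun h' => (h' rfl).elim, fun _ => (h p.1).2 (by rw [hp]; exact fun h' => RowType.noConfusion h')⟩
  · rw [rowLoad_cons_of_not_mem _ _ (by rw [mem_eqRows_singleton]; exact hi)]
    exact h i

/-- **Fibred realisation** (S2 inside the state): a realisable label column is carried by a matrix of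
the fibred set. -/
theorem exists_XE (hLU : PerRowLU g m q) {E : AffSys m n} (hload : ∀ i, rowLoad E i ≤ q)
    (hsat : ∃ X, Sat E X) {S : Fin m → Set (Fin n → Bool)} (htyped : ∀ i, rowLoad E i = 0 ∨ S i = Set.univ)
    {A : Set (Fin m → Bool)} {a : Fin m → Bool} (ha : a ∈ AE g A S) :
    ∃ X ∈ XSetE g A S E, rowLabels g X = a := by
  obtain ⟨X, hX, hlab, hrows⟩ := exists_X_fibred' hLU hload hsat S htyped ha.2
  exact ⟨X, ⟨by rw [hlab]; exact ha.1, hrows, hX⟩, hlab⟩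

/-- Fibred realisation with a prescribed equation-free row. -/
theorem exists_XE_row (hLU : PerRowLU g m q) {E : AffSys m n} (hload : ∀ i, rowLoad E i ≤ q)
    (hsat : ∃ X, Sat E X) {S : Fin m → Set (Fin n → Bool)} (htyped : ∀ i, rowLoad E i = 0 ∨ S i = Set.univ)
    {A : Set (Fin m → Bool)} {a : Fin m → Bool} (ha : a ∈ AE g A S) {i : Fin m} (hi : rowLoad E i = 0)
    {x : Fin n → Bool} (hx : x ∈ S i) (hgx : g x = a i) :
    ∃ X ∈ XSetE g A S E, rowLabels g X = a ∧ row X i = x := by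
  obtain ⟨X, hX, hlab, hrows, hrow⟩ := exists_X_fibred hLU hload hsat S htyped ha.2 hi hx hgx
  exact ⟨X, ⟨by rw [hlab]; exact ha.1, hrows, hX⟩, hlab, hrow⟩

/-- Which subtree the play enters on the bit `β`, with its invariant and depth bound (Alice node). -/
theorem alice_childAt {τ : Fin m → RowType} {s : (Fin m × Fin n → Bool) → Bool}
    {P Q : KWTree (Fin m × Fin n)} (hIP : InvAt g q τ P) (hIQ : InvAt g q τ Q) (β : Bool) :
    ∃ C : KWTree (Fin m × Fin n), InvAt g q τ C ∧ C.depth ≤ max P.depth Q.depth ∧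
      ∀ X Y, s X = β → (KWTree.alice s P Q).run X Y = C.run X Y := by
  cases β
  · exact ⟨P, hIP, le_max_left _ _, fun X Y h => by simp [h]⟩
  · exact ⟨Q, hIQ, le_max_right _ _, fun X Y h => by simp [h]⟩

/-- Which subtree the play enters on the bit `β` (Bob node). -/
theorem bob_childAt {τ : Fin m → RowType} {s : (Fin m × Fin n → Bool) → Bool}
    {P Q : KWTree (Fin m × Fin n)} (hIP : InvAt g q τ P) (hIQ : InvAt g q τ Q) (β : Bool) :
    ∃ C : KWTree (Fin m × Fin n), InvAt g q τ C ∧ C.depth ≤ max P.depth Q.depth ∧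
      ∀ X Y, s Y = β → (KWTree.bob s P Q).run X Y = C.run X Y := by
  cases β
  · exact ⟨P, hIP, le_max_left _ _, fun X Y h => by simp [h]⟩
  · exact ⟨Q, hIQ, le_max_right _ _, fun X Y h => by simp [h]⟩

end StateLemmas

end Summit.PneNP.PneNP.Theorems.KrwLrad
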